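import Literature.MathematicalPhysics.QuantumFieldTheory.Balaban1983to89.B9Eq360DeltaPrimeAY
import Literature.MathematicalPhysics.QuantumFieldTheory.Balaban1983to89.B9SectBCodedCarrier
import Literature.MathematicalPhysics.QuantumFieldTheory.Balaban1983to89.B9PinMembersKLevelV1
import Literature.MathematicalPhysics.QuantumFieldTheory.Balaban1983to89.B6QGQCoerciveMultiLevelBox
import Literature.MathematicalPhysics.QuantumFieldTheory.Balaban1983to89.B9Ineq344CutoffDatumTorus
import Literature.MathematicalPhysics.QuantumFieldTheory.Balaban1983to89.B9GeoLemma21KLevelV1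
import Literature.MathematicalPhysics.QuantumFieldTheory.Balaban1983to89.B9Thm311DeltaPrimePos

/-!
# `Balaban1983to89.B9SectBGpLettersY` — THE G′-FRAME LETTERS OF NODE 00 ON THE CODED CONFIGURATIONS (per index) and their laws in the exact
# field shapes of `B9SectBGpStepAtLettersV2.GpFrame₂`: `unitary`, (3.19)∕(3.24) sizes, `card_w`, `gop_eq`, `reg_inv`, ★ `mul_law` ((3.60)), stencils

T. Bałaban, *Propagators for lattice gauge theories in a background field*, Commun. Math. Phys. **99** (1985) 389–434
[`Balaban1985BackgroundPropagators`, "B9"]; [4] = T. Bałaban, *Propagators and renormalization transformations for lattice gauge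
theories. II*, Commun. Math. Phys. **96** (1984) 223–250 [`Balaban1984PropagatorsII`].

statement-level skeleton of published theorems with citation tags; proofs where landed; nothing here is a claim about the
Yang–Mills mass gap

THE PRINTED LOCI.  (3.19) p. 393 *"(Q′_j(U)λ)(y) = Σ_{x∈B^j(y)} L^{−jd} R(U(Γ^{(j)}_{y,x})) λ(x)"*; (3.24)–(3.25) pp. 394–395 (Δ′_a(U), «Its inverse is
denoted by G′»); (3.35) p. 396 («U … with values in G»); (3.37) p. 396 («U′ = e^{iηA′}»); (3.60) p. 402; Thm 3.11 p. 416; [4] (2.46) p. 231 (the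
multiscale distance), (2.51) p. 232 (block majorants), (2.69) p. 235 (the block weight `W`).

WHY THIS FILE (pub-ymgap N06 row 13, seat dag-n06-c gen 7; LOCATED-6 + its repair).  The root Sect.-B letters dictionary `GpFrame₂` asks, per member,
for LETTERS — shifts `T`, block map `blk`, coordinates `coord`, the (3.19)∕(3.24) data `kQ sQ w cfun`, the (3.37) exponent `expA` and variations
`kF sF`, the operators `Δp Gop Lap` in real coordinates — and LAWS about them.  Over the record's carrier `bg9Y` they have no instance (LOCATED-6: the
size fields quantify over every configuration); over the CODED carrier of `B9SectBCodedCarrier` they do.  This file defines NODE 00's letters as TOTAL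
functions of a coded configuration `CCfg (CfgY 𝔸 i) (AfldY 𝔸 i)` (`base U` ∣ `mult a` ∣ `prod U a`, decoded by `decY`) and proves the per-index laws:
* §1 `decY` (the decoding `base U ↦ U`, `mult a ↦ e^{iηa}`, `prod U a ↦ e^{iηa}U`, `η = (kGeo i).eta`).
* §2 LETTERS: `GVal` («U G-valued»); `coordC` = the charted bond variables `UboxY U` at a G-valued base, `1` elsewhere; `expAC` = `chartA a` at a
  (base, `mult a`) pair, `0` elsewhere; `blkC ιB := ιB ∘ blkY` (blocks labelled by index bonds through a section `ιB` of `β`); `kQC`∕`sQC` =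
  `B9Eq360DeltaPrimeAY.kQY ∘ β` ∕ `sQY` at a G-valued base, `0` elsewhere; `kFC`∕`sFC` = `kFY`∕`sFY` at (base, mult); `wC b = W_{β b}⁻¹`; `cfunC b =
  η⁻²·cY (β b)`; `ΔpC c = conj b (η⁻²·Δ′_a(decY c))`, `GopC c = conj b (η²·G′(decY c))`, `LapC c = conj b (η⁻²·Δ_{decY c})` — GENUINE AT EVERY coded
  configuration (NODE 00's `deltaPrimeAY`, `GpY`, `lapSL`; print's units).
* §3 SIZES: ★ `coordC_unitary` (the field `unitary` — at every coded configuration), `wC_nonneg`, `norm_Rclm_le(_one)`, `norm_kQY_le`, `norm_sQY_le`,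
  ★ `kQC_norm_le`, ★ `sQC_norm_le` (fields `hkQ`, `hsQ`: unitary transports, `G`-elements of norm ≦ 1), ★ `card_blkC_mul_wC_le` (field `card_w`:
  `#B(y)·W⁻¹ ≦ 1`, `B6QGQCoerciveMultiLevelBox.card_blkOf_eq`), ★ `cfunC_abs_le` (field `hcfun` with `a₀ = 1`: `cfun b = a_j(Lʲη)⁻²`, `a_j ≦ 1`).
* §4 LAWS: `conj_one`; ★ `gopC_eq` (field `gop_eq`: a two-sided inverse of `conj b(η⁻²Δ′_a)` forces `Δ′_a` bijective, hence a unit of `End_ℂ`, and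
  is `conj b(η²·Ring.inverse Δ′_a)`); ★ `ΔpC_mul_GopC` (field `reg_inv` from `IsUnit Δ′_a(U)` — Thm 3.11, at the record n06-j's
  `B9Thm311DeltaPrimePos.isUnit_deltaPrimeAY_parSymY`); `letters_base_of_gVal`; ★★ `ΔpC_mul_law` (field `mul_law`: **(3.60) at the letters** —
  `B9Eq360DeltaPrimeAY.eq360_deltaPrimeAY` conjugated by `conj b` and relabelled by `vPrimeConc_reindex` along `ιB`); `dist_blkC`, `abs_unitVec_le`,
  ★ `stencilF_blkC`, ★ `stencilB_blkC`, `stencil0_geo9K` (fields `stencilF`∕`stencilB`∕`stencil0` with `d₀ = 2(d+1)`: p21's `distT_blkOf_tshift_le`).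
The family-level assembly into `GpFrame₂` over the coding of `bg9Y` is `B9SectBGpFrameCodedY`.

HONEST SCOPE.  Definitions and finite-dimensional bookkeeping about NODE 00's DEFINED operators; the block labels `ιB` are a SECTION of `β` (`hι`),
which exists exactly at the CORNER-FREE members (`B9BetaRangeKLevelV1.surjective_beta_iff`; ref-E READ-1∕10) — at a cornered member every statement displaying `hι`
is vacuous (a quasi-section at bounded distance would serve the same estimates with larger constants; not done here; v1.1 doc-only note); the one genuine (3.60) identity is imported; NO
estimate of [B9] ((3.42) readings, (3.58)) is proved or asserted here; COUNT-NEUTRAL; N06 NOT discharged; one finite lattice programme — nothing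
continuum ∕ OS ∕ mass-gap ∕ Clay.  Cell `pub-ymgap` (HUMAN RULING D-0062), Track A node N06 [B9], N06-ASSIGNMENT row 13, 2026-08-27.

RELATED IN THE TREE, NOT DUPLICATED: `B9Eq360DeltaPrimeAY` (letters `kQY sQY cY kFY sFY blkY mulY chartA Rclm`, `eq360_deltaPrimeAY`,
`vPrimeConc_reindex`), `B9SectBCodedCarrier` (`CCfg`), `Node00.OpsYDeltaPrimeA` (`deltaPrimeAY`, `GpY`, inverse laws), `B9Thm311ReadingAtLetters`
(`wB`), `B6QGQCoerciveMultiLevelBox` (`card_blkOf_eq`), `B6Ineq268MultiLevelBox` (`W_eq`), `B6Ineq2142KLevelV1` (`β`, `beta_level`),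
`B9Ineq344CutoffDatumTorus` (`distT_blkOf_tshift_le`), `B9GeoLemma21KLevelV1`∕`B9GeoNormsKLevelV1` (geometry of `geo9K`), `B6Prop23KLevelTorusCensus`
(`aPrinted_pos`, `aPrinted_le_one`) — USED BY NAME; no existing module modified.
-/

noncomputable section

namespace Literature.MathematicalPhysics.QuantumFieldTheory.Balaban1983to89.B9SectBGpLettersY

open Literature.MathematicalPhysics.QuantumFieldTheory.Balaban1983to89.B9Eq39Adjoint (R fluct)
open Literature.MathematicalPhysics.QuantumFieldTheory.Balaban1983to89.B9Eq352DivFormLetters (conj conj_mul conj_sub)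
open Literature.MathematicalPhysics.QuantumFieldTheory.Balaban1983to89.B9Eq360VprimeLetters (vPrimeConc)
open Literature.MathematicalPhysics.QuantumFieldTheory.Balaban1983to89.B6KLevelCensusIndexV1 (KIdx kGeo)
open Literature.MathematicalPhysics.QuantumFieldTheory.Balaban1983to89.B6Geom246MultiLevelBox (bset blkOf)
open Literature.MathematicalPhysics.QuantumFieldTheory.Balaban1983to89.B6Ineq2142KLevelV1 (β lvl)
open Literature.MathematicalPhysics.QuantumFieldTheory.Balaban1983to89.B9BackgroundsKLevelV1 (CfgV1 bg9K)
open Literature.MathematicalPhysics.QuantumFieldTheory.Balaban1983to89.B9Thm311ReadingAtLetters (wB wB_pos)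
open Literature.MathematicalPhysics.QuantumFieldTheory.Balaban1983to89.B9SectBCodedCarrier (CCfg)
open Literature.MathematicalPhysics.QuantumFieldTheory.Balaban1983to89.B9Eq360DeltaPrimeAY (Rclm Rclm_apply blkY blkY_apply kQY sQY cY kFY sFY
  mulY AfldY chartA kQY_apply sQY_apply)
open Literature.MathematicalPhysics.QuantumFieldTheory.Balaban1983to89.Node00 (SiteY BlkY IBondY CfgY SiteParY UboxY shiftY lapSL deltaPrimeAY GpY
  blkCornerY)

variable {d ℓ : ℕ} {hd : 1 ≤ d + 1} {hL : Odd (ℓ + 1) ∧ 1 < ℓ + 1} {b₀ b₁ : ℝ}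
variable {𝔸 : Type} [NormedRing 𝔸] [NormedAlgebra ℂ 𝔸] [CompleteSpace 𝔸]

/-! ## §1 The decoding of a coded configuration of the member -/

section Decode

variable (i : KIdx d ℓ hd hL b₀ b₁)

/-- the DECODING of a coded configuration of the member: `base U ↦ U`, `mult a ↦ e^{iηa}`, `prod U a ↦ e^{iηa}·U` (`η = (kGeo i).eta`; this is
`Coding.dec` of every coding of the member's backgrounds by the fields `A′`). [cite: Balaban1985BackgroundPropagators, (3.37) p.396, Thm 3.4 p.400, bookkeeping] -/
def decY : CCfg (CfgY 𝔸 i) (AfldY 𝔸 i) → CfgY 𝔸 i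
  | .base U => U
  | .mult a => fluct (kGeo i).eta a
  | .prod U a => mulY i (fluct (kGeo i).eta a) U

/-- `decY (base U) = U`. [cite: Balaban1985BackgroundPropagators, (3.35) p.396, bookkeeping] -/
@[simp] theorem decY_base (U : CfgY 𝔸 i) : decY i (.base U) = U := rfl
/-- `decY (mult a) = e^{iηa}`. [cite: Balaban1985BackgroundPropagators, (3.37) p.396, bookkeeping] -/
@[simp] theorem decY_mult (a : AfldY 𝔸 i) : decY i (.mult a) = fluct (kGeo i).eta a := rfl
/-- `decY (prod U a) = e^{iηa}·U`. [cite: Balaban1985BackgroundPropagators, Thm 3.4 p.400, bookkeeping] -/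
@[simp] theorem decY_prod (U : CfgY 𝔸 i) (a : AfldY 𝔸 i) : decY i (.prod U a) = mulY i (fluct (kGeo i).eta a) U := rfl

end Decode

/-! ## §2 The letters, total on the coded configurations -/

section Letters

variable (G : Subgroup 𝔸ˣ) (i : KIdx d ℓ hd hL b₀ b₁) (par : SiteParY 𝔸 i) {ι : Type} [Fintype ι] (b : Module.Basis ι ℝ 𝔸)
  (ιB : BlkY i → IBondY i)

/-- «U is G-valued» (the first clause of the record's (3.35) field `Reg335Body`). [cite: Balaban1985BackgroundPropagators, (3.35) p.396 («U … with values in G»)] -/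
def GVal (U : CfgY 𝔸 i) : Prop := ∀ μ y, U μ y ∈ G

open Classical in
/-- **the background coordinates `coord`**: the genuine charted bond variables `UboxY U` at a G-valued base configuration, the trivial configuration elsewhere
(multipliers, products, non-G-valued bases — never the base of a Sect.-B step). [cite: Balaban1985BackgroundPropagators, (3.35) p.396, (3.1) p.390] -/
def coordC : CCfg (CfgY 𝔸 i) (AfldY 𝔸 i) → Fin (d + 1) → SiteY i → 𝔸ˣ
  | .base U => if GVal G i U then UboxY i U else fun _ _ => 1
  | _ => fun _ _ => 1

/-- **the exponent letter `expA`**: the charted field `A′` of the multiplier at a base configuration, `0` elsewhere.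
[cite: Balaban1985BackgroundPropagators, (3.37) p.396 («U′ = e^{iηA′}»)] -/
def expAC : CCfg (CfgY 𝔸 i) (AfldY 𝔸 i) → CCfg (CfgY 𝔸 i) (AfldY 𝔸 i) → Fin (d + 1) → SiteY i → 𝔸
  | .base _, .mult a => chartA i a
  | _, _ => fun _ _ => 0

/-- **the block map of the frame**: NODE 00's block map `𝔅` followed by a labelling `ιB : 𝔅 → (geo9K i).Site` of blocks by index bonds.
[cite: Balaban1985BackgroundPropagators, p.397 (𝔅), dictionary] -/
def blkC : SiteY i → IBondY i := fun z => ιB (blkY i z)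

open Classical in
/-- **the (3.19) kernel letter `kQ`** on the coded carrier: genuine (`kQY`, blocks read through `β`) at a G-valued base, `0` elsewhere.
[cite: Balaban1985BackgroundPropagators, (3.19) p.393] -/
def kQC : CCfg (CfgY 𝔸 i) (AfldY 𝔸 i) → IBondY i → SiteY i → 𝔸 →L[ℝ] 𝔸
  | .base U => if GVal G i U then fun bnd w => kQY i par U (β i.hN i.D i.hk bnd) w else fun _ _ => 0
  | _ => fun _ _ => 0

open Classical in
/-- **the Q′\* letter `sQ`** on the coded carrier: genuine (`sQY`) at a G-valued base, `0` elsewhere. [cite: Balaban1985BackgroundPropagators, (3.24) p.394] -/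
def sQC : CCfg (CfgY 𝔸 i) (AfldY 𝔸 i) → SiteY i → 𝔸 →L[ℝ] 𝔸
  | .base U => if GVal G i U then sQY i par U else fun _ => 0
  | _ => fun _ => 0

/-- **the variation letter `kF`** ((3.57): `Q′(U′U) = Q′(U) + F′₂`) on the coded carrier: genuine at a (base, multiplier) pair, `0` elsewhere.
[cite: Balaban1985BackgroundPropagators, (3.57)–(3.58) pp.401–402] -/
def kFC : CCfg (CfgY 𝔸 i) (AfldY 𝔸 i) → CCfg (CfgY 𝔸 i) (AfldY 𝔸 i) → IBondY i → SiteY i → 𝔸 →L[ℝ] 𝔸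
  | .base U, .mult a => fun bnd w => kFY i par U (mulY i (fluct (kGeo i).eta a) U) (β i.hN i.D i.hk bnd) w
  | _, _ => fun _ _ => 0

/-- **the variation letter `sF`** ((3.59)) on the coded carrier. [cite: Balaban1985BackgroundPropagators, (3.59) p.402] -/
def sFC : CCfg (CfgY 𝔸 i) (AfldY 𝔸 i) → CCfg (CfgY 𝔸 i) (AfldY 𝔸 i) → SiteY i → 𝔸 →L[ℝ] 𝔸
  | .base U, .mult a => sFY i par U (mulY i (fluct (kGeo i).eta a) U)
  | _, _ => fun _ => 0

/-- **the (3.19) size weight `w`**: `W_{s(b)}⁻¹`, the inverse volume of the block of the index bond (`L^{−jd}` in print). [cite: Balaban1985BackgroundPropagators, (3.19) p.393] -/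
def wC : CCfg (CfgY 𝔸 i) (AfldY 𝔸 i) → IBondY i → ℝ := fun _ bnd => (wB i (β i.hN i.D i.hk bnd))⁻¹

/-- **the weight letter `a` of (3.24)**, print's units: `cfun b = η⁻²·levC_{j(b)}·W_{s(b)}` (`= a_j(Lʲη)⁻²` at the block of `b`).
[cite: Balaban1985BackgroundPropagators, (3.24) p.394] -/
def cfunC : IBondY i → ℝ := fun bnd => ((kGeo i).eta ^ 2)⁻¹ * cY i (β i.hN i.D i.hk bnd)

/-- **the letter `Δp = Δ′_a(V)`**, print's units, in real coordinates, at EVERY coded configuration (genuine at its decoding):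
`conj b (η⁻²·Δ′_a(dec V))`. [cite: Balaban1985BackgroundPropagators, (3.24) p.394] -/
def ΔpC (c : CCfg (CfgY 𝔸 i) (AfldY 𝔸 i)) : Module.End ℝ (SiteY i × ι → ℝ) :=
  conj b (((kGeo i).eta ^ 2)⁻¹ • (deltaPrimeAY i par (decY i c)).restrictScalars ℝ)

/-- **the letter `Gop = G′(V)`**, print's units, in real coordinates, at every coded configuration: `conj b (η²·G′(dec V))`, `G′ = Node00.GpY`.
[cite: Balaban1985BackgroundPropagators, (3.25) p.395] -/
def GopC (c : CCfg (CfgY 𝔸 i) (AfldY 𝔸 i)) : Module.End ℝ (SiteY i × ι → ℝ) :=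
  conj b (((kGeo i).eta ^ 2) • (GpY i par (decY i c)).restrictScalars ℝ)

/-- **the letter `Lap = Δ_V`** (the fourth (3.42) entry's Laplacian), print's units, in real coordinates: `conj b (η⁻²·Δ_{dec V})`.
[cite: Balaban1985BackgroundPropagators, (3.23) p.394, (3.42) p.397] -/
def LapC (c : CCfg (CfgY 𝔸 i) (AfldY 𝔸 i)) : Module.End ℝ (SiteY i × ι → ℝ) :=
  conj b (((kGeo i).eta ^ 2)⁻¹ • (lapSL i (decY i c)).restrictScalars ℝ)

end Letters

/-! ## §3 The size laws of the letters (the fields `unitary`, `w_nonneg`, `card_w`, `hkQ`, `hsQ`, `hcfun` of `GpFrame₂`) -/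

section Sizes

variable (G : Subgroup 𝔸ˣ) (i : KIdx d ℓ hd hL b₀ b₁) (par : SiteParY 𝔸 i) (ιB : BlkY i → IBondY i)

omit [NormedAlgebra ℂ 𝔸] [CompleteSpace 𝔸] in
/-- a `G`-valued unit has norms `≦ 1` together with its inverse when every element of `G` has norm `≦ 1` (`G ≤ U(N)` at the record).
[cite: Balaban1985BackgroundPropagators, (3.35) p.396 («values in G»), bookkeeping] -/
theorem norm_le_one_and_inv_of_mem {u : 𝔸ˣ} (hG1 : ∀ u : 𝔸ˣ, u ∈ G → ‖(u : 𝔸)‖ ≤ 1) (hu : u ∈ G) :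
    ‖(u : 𝔸)‖ ≤ 1 ∧ ‖((u⁻¹ : 𝔸ˣ) : 𝔸)‖ ≤ 1 :=
  ⟨hG1 u hu, hG1 u⁻¹ (inv_mem hu)⟩

/-- ★ FIELD `unitary`: the coordinates are unitary-type AT EVERY CODED CONFIGURATION (genuine `G`-valued bond variables at a `G`-valued base, `1` elsewhere).
[cite: Balaban1985BackgroundPropagators, (3.35) p.396] -/
theorem coordC_unitary [NormOneClass 𝔸] (hG1 : ∀ u : 𝔸ˣ, u ∈ G → ‖(u : 𝔸)‖ ≤ 1) (c : CCfg (CfgY 𝔸 i) (AfldY 𝔸 i)) (m : Fin (d + 1)) (z : SiteY i) :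
    ‖((coordC G i c m z : 𝔸ˣ) : 𝔸)‖ ≤ 1 ∧ ‖(((coordC G i c m z)⁻¹ : 𝔸ˣ) : 𝔸)‖ ≤ 1 := by
  have h1 : ‖(((1 : 𝔸ˣ) : 𝔸ˣ) : 𝔸)‖ ≤ 1 ∧ ‖((((1 : 𝔸ˣ))⁻¹ : 𝔸ˣ) : 𝔸)‖ ≤ 1 := by simp
  match c with
  | .base U =>
    by_cases hU : GVal G i U
    · simp only [coordC, if_pos hU]
      exact norm_le_one_and_inv_of_mem G hG1 (hU m _)
    · simp only [coordC, if_neg hU]; exact h1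
  | .mult _ => exact h1
  | .prod _ _ => exact h1

/-- FIELD `w_nonneg`. [cite: Balaban1985BackgroundPropagators, (3.19) p.393, bookkeeping] -/
theorem wC_nonneg (c : CCfg (CfgY 𝔸 i) (AfldY 𝔸 i)) (bnd : IBondY i) : 0 ≤ wC i c bnd :=
  inv_nonneg.2 (wB_pos i _).le

omit [CompleteSpace 𝔸] in
/-- `R(u)` as a CLM has norm `≦ ‖u‖·‖u⁻¹‖`. [cite: Balaban1985BackgroundPropagators, (3.1) p.390, bookkeeping] -/
theorem norm_Rclm_le (u : 𝔸ˣ) : ‖Rclm u‖ ≤ ‖(u : 𝔸)‖ * ‖((u⁻¹ : 𝔸ˣ) : 𝔸)‖ :=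
  ContinuousLinearMap.opNorm_mulLeftRight_apply_apply_le ℝ 𝔸 _ _

omit [CompleteSpace 𝔸] in
/-- `R(u)` as a CLM has norm `≦ 1` for a unitary-type `u`. [cite: Balaban1985BackgroundPropagators, (3.19) p.393 («R(U(Γ))»), bookkeeping] -/
theorem norm_Rclm_le_one {u : 𝔸ˣ} (hu : ‖(u : 𝔸)‖ ≤ 1 ∧ ‖((u⁻¹ : 𝔸ˣ) : 𝔸)‖ ≤ 1) : ‖Rclm u‖ ≤ 1 :=
  (norm_Rclm_le u).trans (by nlinarith [norm_nonneg (u : 𝔸), norm_nonneg (((u⁻¹ : 𝔸ˣ) : 𝔸))])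

/-- the (3.19) kernel letter is bounded by the inverse block volume when its transport is unitary-type: `‖kQ(s,w)‖ ≦ W_s⁻¹`.
[cite: Balaban1985BackgroundPropagators, (3.19) p.393 («L^{−jd} R(U(Γ))»)] -/
theorem norm_kQY_le (U : CfgY 𝔸 i) (s : BlkY i) (w : SiteY i)
    (hu : ‖((par U (blkCornerY i s) w : 𝔸ˣ) : 𝔸)‖ ≤ 1 ∧ ‖(((par U (blkCornerY i s) w)⁻¹ : 𝔸ˣ) : 𝔸)‖ ≤ 1) :
    ‖kQY i par U s w‖ ≤ (wB i s)⁻¹ := by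
  unfold kQY
  rw [norm_smul, Real.norm_eq_abs, abs_of_nonneg (inv_nonneg.2 (wB_pos i s).le)]
  exact mul_le_of_le_one_right (inv_nonneg.2 (wB_pos i s).le) (norm_Rclm_le_one hu)

/-- the Q′\* letter is bounded by one when its transport is unitary-type. [cite: Balaban1985BackgroundPropagators, (3.24) p.394] -/
theorem norm_sQY_le (U : CfgY 𝔸 i) (z : SiteY i)
    (hu : ‖((par U z (blkCornerY i (blkY i z)) : 𝔸ˣ) : 𝔸)‖ ≤ 1 ∧ ‖(((par U z (blkCornerY i (blkY i z)))⁻¹ : 𝔸ˣ) : 𝔸)‖ ≤ 1) :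
    ‖sQY i par U z‖ ≤ 1 := by
  unfold sQY
  exact norm_Rclm_le_one hu

/-- ★ FIELD `hkQ` ((3.19): `|Q′-kernel| ≦ L^{−jd}` with unit transports): `‖kQ(V; b, w)‖ ≦ W_{s(b)}⁻¹` at every coded configuration, for a transporter table
with values in `G` at `G`-valued configurations. [cite: Balaban1985BackgroundPropagators, (3.19) p.393] -/
theorem kQC_norm_le (hG1 : ∀ u : 𝔸ˣ, u ∈ G → ‖(u : 𝔸)‖ ≤ 1) (hpar : ∀ U : CfgY 𝔸 i, GVal G i U → ∀ z w, par U z w ∈ G)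
    (c : CCfg (CfgY 𝔸 i) (AfldY 𝔸 i)) (bnd : IBondY i) (w : SiteY i) : ‖kQC G i par c bnd w‖ ≤ wC i c bnd := by
  have h0 : ‖(0 : 𝔸 →L[ℝ] 𝔸)‖ ≤ wC i c bnd := by rw [norm_zero]; exact wC_nonneg i c bnd
  match c with
  | .base U =>
    by_cases hU : GVal G i U
    · simp only [kQC, if_pos hU, wC]
      exact norm_kQY_le i par U _ w (norm_le_one_and_inv_of_mem G hG1 (hpar U hU _ _))
    · simp only [kQC, if_neg hU]; exact h0
  | .mult _ => exact h0
  | .prod _ _ => exact h0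

/-- ★ FIELD `hsQ` (transports of norm ≦ 1): `‖sQ(V; z)‖ ≦ 1` at every coded configuration. [cite: Balaban1985BackgroundPropagators, (3.24) p.394, (3.19) p.393] -/
theorem sQC_norm_le (hG1 : ∀ u : 𝔸ˣ, u ∈ G → ‖(u : 𝔸)‖ ≤ 1) (hpar : ∀ U : CfgY 𝔸 i, GVal G i U → ∀ z w, par U z w ∈ G)
    (c : CCfg (CfgY 𝔸 i) (AfldY 𝔸 i)) (z : SiteY i) : ‖sQC G i par c z‖ ≤ 1 := by
  have h0 : ‖(0 : 𝔸 →L[ℝ] 𝔸)‖ ≤ 1 := by rw [norm_zero]; exact zero_le_one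
  match c with
  | .base U =>
    by_cases hU : GVal G i U
    · simp only [sQC, if_pos hU]
      exact norm_sQY_le i par U z (norm_le_one_and_inv_of_mem G hG1 (hpar U hU _ _))
    · simp only [sQC, if_neg hU]; exact h0
  | .mult _ => exact h0
  | .prod _ _ => exact h0

/-- the block of the frame's block map over an index bond: the genuine block it labels (when the labelling is a section of `β`), else empty —
counted: `#{z : ιB(s(z)) = b}·W_{β b}⁻¹ ≦ 1`. ★ FIELD `card_w` ((3.19): `Σ_{x∈Bʲ(y)} L^{−jd} = 1`).
[cite: Balaban1985BackgroundPropagators, (3.19) p.393; Balaban1984PropagatorsII, (2.69) p.235] -/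
theorem card_blkC_mul_wC_le [instD : DecidableEq (IBondY i)] (hι : ∀ s : BlkY i, β i.hN i.D i.hk (ιB s) = s) (c : CCfg (CfgY 𝔸 i) (AfldY 𝔸 i)) (bnd : IBondY i) :
    ((B9Eq360Vprime.block (blkC i ιB) bnd).card : ℝ) * wC i c bnd ≤ 1 := by
  classical
  have hinj : Function.Injective ιB := fun s t h => by rw [← hι s, ← hι t, h]
  by_cases hb : ∃ s, ιB s = bnd
  · obtain ⟨s, rfl⟩ := hb
    have hcard0 : ((Finset.univ.filter (fun z : SiteY i => blkOf i.D.toDomains z = s)).card : ℝ) = wB i s := by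
      convert B6QGQCoerciveMultiLevelBox.card_blkOf_eq i.D.toDomains s using 4 <;> rfl
    have hset : B9Eq360Vprime.block (blkC i ιB) (ιB s) = Finset.univ.filter (fun z : SiteY i => blkOf i.D.toDomains z = s) := by
      ext z
      simp only [B9Eq360Vprime.block, Finset.mem_filter, Finset.mem_univ, true_and, blkC, blkY_apply, hinj.eq_iff]
    have hcard : ((B9Eq360Vprime.block (blkC i ιB) (ιB s)).card : ℝ) = wB i s := by rw [hset, hcard0]
    rw [wC, hι, hcard]
    exact le_of_eq (mul_inv_cancel₀ (wB_pos i s).ne')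
  · have hset : B9Eq360Vprime.block (blkC i ιB) bnd = ∅ := by
      ext z
      simp only [B9Eq360Vprime.block, Finset.mem_filter, Finset.mem_univ, true_and, blkC, Finset.notMem_empty, iff_false]
      exact fun h => hb ⟨_, h⟩
    rw [hset, Finset.card_empty, Nat.cast_zero, zero_mul]
    exact zero_le_one

end Sizes

/-! ## §4 The weight letter, the inverse laws, the (3.60) law and the stencils -/

section Laws

variable (G : Subgroup 𝔸ˣ) (i : KIdx d ℓ hd hL b₀ b₁) (par : SiteParY 𝔸 i) {ι : Type} [Fintype ι] (b : Module.Basis ι ℝ 𝔸)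
  (ιB : BlkY i → IBondY i)

omit [NormedRing 𝔸] [NormedAlgebra ℂ 𝔸] [CompleteSpace 𝔸] in
/-- `levC_j · W_s = a_j · (Lʲ)⁻²` for a block `s` of level `j` (`W_s = L^{j(d+1)}` cancels `L^{−j(d+1)}`). [cite: Balaban1984PropagatorsII, (2.14) p.225, (2.69) p.235, bookkeeping] -/
theorem cY_eq (s : BlkY i) :
    cY i s = B6MultiLevelBoxOperator.aPrinted ℓ 1 s.1.1 * ((((ℓ : ℝ) + 1) ^ s.1.1) ^ 2)⁻¹ := by
  have hL : (0 : ℝ) < ((ℓ : ℝ) + 1) ^ s.1.1 := by positivity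
  rw [cY, B6MultiLevelBoxOperator.levC, wB, B6Ineq268MultiLevelBox.W_eq, mul_assoc, inv_mul_cancel₀ (pow_ne_zero _ hL.ne'), mul_one]

omit [NormedRing 𝔸] [NormedAlgebra ℂ 𝔸] [CompleteSpace 𝔸] in
/-- ★ FIELD `hcfun` ((3.24): «0 ≦ a_j ≦ a₀», here `a₀ = 1`): `|cfun(b)| ≦ 1·((geo9K i).len b)⁻²` — `cfun(b) = a_j(Lʲη)⁻²` at the level `j` of `b`'s block.
[cite: Balaban1985BackgroundPropagators, (3.24) p.394; Balaban1984PropagatorsII, (2.14) p.225] -/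
theorem cfunC_abs_le (bnd : IBondY i) : |cfunC i bnd| ≤ 1 * ((B9GeoNormsKLevelV1.geo9K i).len bnd ^ 2)⁻¹ := by
  have hk1 : 1 ≤ i.k := le_trans one_le_two i.hk2
  set s := β i.hN i.D i.hk bnd with hs
  have hj : (B9GeoNormsKLevelV1.geo9K i).len bnd = ((ℓ : ℝ) + 1) ^ s.1.1 * (kGeo i).eta := by
    rw [B9GeoNormsKLevelV1.geo9K_len_kGeo]
    show (kGeo i).L ^ (kGeo i).scale bnd * (kGeo i).eta = _
    rw [show (kGeo i).scale bnd = lvl i.hN i.D i.hk bnd from rfl, ← B6Ineq2142KLevelV1.beta_level i.hN i.D i.hk hk1 bnd, ← hs]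
    simp
  have ha0 : 0 ≤ B6MultiLevelBoxOperator.aPrinted ℓ 1 s.1.1 :=
    (B6Prop23KLevelTorusCensus.aPrinted_pos (B9Cor35AtOneInverseLetters.one_le_ell i) _ (B9Thm311DeltaPrimePos.one_le_level i s)).le
  have ha1 : B6MultiLevelBoxOperator.aPrinted ℓ 1 s.1.1 ≤ 1 :=
    B6Prop23KLevelTorusCensus.aPrinted_le_one (B9Cor35AtOneInverseLetters.one_le_ell i) _ (B9Thm311DeltaPrimePos.one_le_level i s)
  have hη : 0 < (kGeo i).eta := by
    show 0 < |i.cf|⁻¹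
    exact inv_pos.2 (abs_pos.2 i.hcf)
  have hL : (0 : ℝ) < ((ℓ : ℝ) + 1) ^ s.1.1 := by positivity
  rw [cfunC, ← hs, cY_eq, hj, abs_of_nonneg (by positivity), one_mul, mul_pow, mul_inv, mul_comm, mul_assoc]
  calc B6MultiLevelBoxOperator.aPrinted ℓ 1 s.1.1 * (((((ℓ : ℝ) + 1) ^ s.1.1) ^ 2)⁻¹ * ((kGeo i).eta ^ 2)⁻¹)
      ≤ 1 * (((((ℓ : ℝ) + 1) ^ s.1.1) ^ 2)⁻¹ * ((kGeo i).eta ^ 2)⁻¹) :=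
        mul_le_mul_of_nonneg_right ha1 (by positivity)
    _ = ((((ℓ : ℝ) + 1) ^ s.1.1) ^ 2)⁻¹ * ((kGeo i).eta ^ 2)⁻¹ := one_mul _

omit [CompleteSpace 𝔸] in
/-- `conj b` preserves `1`. [cite: Balaban1984PropagatorsII, (2.51) p.232, bookkeeping] -/
theorem conj_one {S : Type} : conj b (1 : Module.End ℝ (S → 𝔸)) = 1 := by
  refine LinearMap.ext fun μ => ?_
  rw [B9Eq352DivFormLetters.conj, LinearEquiv.conj_apply]
  simp

/-- ★ FIELD `gop_eq`: `G′(V)` IS the two-sided inverse of `Δ′_a(V)` whenever one exists — at every coded configuration: if `ΔpC V = D` has a two-sided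
inverse `X` then `GopC V = X`.  (`conj b` is conjugation by a linear equivalence, `η⁻²Δ′` bijective ⇒ `Δ′` a unit of `End_ℂ`, `Ring.inverse` is then the
inverse, and two-sided inverses are unique.) [cite: Balaban1985BackgroundPropagators, (3.25) p.395 («Its inverse is denoted by G′»)] -/
theorem gopC_eq (c : CCfg (CfgY 𝔸 i) (AfldY 𝔸 i)) (D X : Module.End ℝ (SiteY i × ι → ℝ))
    (hD : ΔpC i par b c = D) (hDX : D * X = 1) (hXD : X * D = 1) : GopC i par b c = X := by
  set V := decY i c
  set η := (kGeo i).eta with hηdef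
  have hη : η ≠ 0 := by
    rw [hηdef]; show |i.cf|⁻¹ ≠ 0
    exact inv_ne_zero (abs_ne_zero.2 i.hcf)
  have hη2 : (η ^ 2 : ℝ) ≠ 0 := pow_ne_zero 2 hη
  -- the `ℝ`-operator `T := η⁻²·Δ′_a(V)` on `SiteY → 𝔸` is bijective: `conj b T = D` is, and `conj b` conjugates by `coordEquiv b`
  set T : Module.End ℝ (SiteY i → 𝔸) := (η ^ 2)⁻¹ • (deltaPrimeAY i par V).restrictScalars ℝ with hT
  have hconj : conj b T = D := hD
  have hbijD : Function.Bijective D := by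
    refine (Module.End.isUnit_iff D).1 ⟨⟨D, X, hDX, hXD⟩, rfl⟩
  have hbijT : Function.Bijective T := by
    have hTe : (T : (SiteY i → 𝔸) → (SiteY i → 𝔸)) = (B9Eq352DivFormLetters.coordEquiv b).symm ∘ D ∘ (B9Eq352DivFormLetters.coordEquiv b) := by
      funext f
      have := congrArg (fun L : Module.End ℝ (SiteY i × ι → ℝ) => (B9Eq352DivFormLetters.coordEquiv b).symm (L (B9Eq352DivFormLetters.coordEquiv b f))) hconj
      simpa [B9Eq352DivFormLetters.conj, LinearEquiv.conj_apply] using this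
    rw [hTe]
    exact (B9Eq352DivFormLetters.coordEquiv b).symm.bijective.comp (hbijD.comp (B9Eq352DivFormLetters.coordEquiv b).bijective)
  -- hence `Δ′_a(V)` is bijective, a unit of `End_ℂ`
  have hbijΔ : Function.Bijective (deltaPrimeAY i par V) := by
    have hsc : ∀ f, deltaPrimeAY i par V f = (η ^ 2 : ℝ) • T f := fun f => by
      simp only [hT, LinearMap.smul_apply, LinearMap.restrictScalars_apply, smul_smul, mul_inv_cancel₀ hη2, one_smul]
    constructor
    · intro f g hfg
      have h' : (η ^ 2 : ℝ)⁻¹ • ((η ^ 2 : ℝ) • T f) = (η ^ 2 : ℝ)⁻¹ • ((η ^ 2 : ℝ) • T g) := by rw [← hsc, ← hsc, hfg]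
      rw [smul_smul, smul_smul, inv_mul_cancel₀ hη2, one_smul, one_smul] at h'
      exact hbijT.1 h'
    · intro g
      obtain ⟨f, hf⟩ := hbijT.2 ((η ^ 2 : ℝ)⁻¹ • g)
      exact ⟨f, by rw [hsc, hf, smul_smul, mul_inv_cancel₀ hη2, one_smul]⟩
  have hunit : IsUnit (deltaPrimeAY i par V) := (Module.End.isUnit_iff _).2 hbijΔ
  -- `GopC` inverts `ΔpC`, so it is `X`
  have h1 : ΔpC i par b c * GopC i par b c = 1 := by
    rw [ΔpC, GopC, ← B9Eq352DivFormLetters.conj_mul]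
    have : ((η ^ 2)⁻¹ • (deltaPrimeAY i par V).restrictScalars ℝ) * ((η ^ 2) • (GpY i par V).restrictScalars ℝ) = 1 := by
      rw [smul_mul_smul_comm, inv_mul_cancel₀ hη2, one_smul, Module.End.mul_eq_comp, ← LinearMap.restrictScalars_comp,
        ← Module.End.mul_eq_comp, Node00.deltaPrimeAY_mul_GpY i par V hunit]
      rfl
    rw [this, conj_one]
  calc GopC i par b c = (X * D) * GopC i par b c := by rw [hXD, one_mul]
    _ = X * (ΔpC i par b c * GopC i par b c) := by rw [mul_assoc, hD]
    _ = X := by rw [h1, mul_one]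


/-- ★ FIELD `reg_inv` at the letters: at a `G`-valued base configuration where `Δ′_a(U)` is a unit (Theorem 3.11 — at the record `B9Thm311DeltaPrimePos.isUnit_deltaPrimeAY_parSymY`,
every `G`-valued `U`, `G ≤ U(N)`), `ΔpC·GopC = 1 = GopC·ΔpC`. [cite: Balaban1985BackgroundPropagators, (3.25) p.395, Thm 3.11 p.416] -/
theorem ΔpC_mul_GopC (c : CCfg (CfgY 𝔸 i) (AfldY 𝔸 i)) (hunit : IsUnit (deltaPrimeAY i par (decY i c))) :
    ΔpC i par b c * GopC i par b c = 1 ∧ GopC i par b c * ΔpC i par b c = 1 := by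
  have hη : (kGeo i).eta ≠ 0 := by
    show |i.cf|⁻¹ ≠ 0
    exact inv_ne_zero (abs_ne_zero.2 i.hcf)
  have hη2 : ((kGeo i).eta ^ 2 : ℝ) ≠ 0 := pow_ne_zero 2 hη
  constructor
  · rw [ΔpC, GopC, ← B9Eq352DivFormLetters.conj_mul, smul_mul_smul_comm, inv_mul_cancel₀ hη2, one_smul, Module.End.mul_eq_comp,
      ← LinearMap.restrictScalars_comp, ← Module.End.mul_eq_comp, Node00.deltaPrimeAY_mul_GpY i par _ hunit]
    exact conj_one b
  · rw [ΔpC, GopC, ← B9Eq352DivFormLetters.conj_mul, smul_mul_smul_comm, mul_inv_cancel₀ hη2, one_smul, Module.End.mul_eq_comp,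
      ← LinearMap.restrictScalars_comp, ← Module.End.mul_eq_comp, Node00.GpY_mul_deltaPrimeAY i par _ hunit]
    exact conj_one b

/-- at a `G`-valued base configuration the letters are the genuine ones. [cite: Balaban1985BackgroundPropagators, (3.35) p.396, bookkeeping] -/
theorem letters_base_of_gVal {U : CfgY 𝔸 i} (hU : GVal G i U) :
    coordC G i (.base U) = UboxY i U ∧ (kQC G i par (.base U) = fun bnd w => kQY i par U (β i.hN i.D i.hk bnd) w) ∧
      sQC G i par (.base U) = sQY i par U := by
  refine ⟨?_, ?_, ?_⟩ <;> simp only [coordC, kQC, sQC, if_pos hU]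

/-- ★ FIELD `mul_law` AT THE LETTERS — **(3.60) in the frames' shape**: at a `G`-valued base configuration `U` and a multiplier `e^{iηa}`,
`Δp(prod U a) = Δp(base U) − conj b (vPrimeConc (shiftY i) (coord (base U)) η (expA (base U) (mult a)) (blkC) (kQ (base U)) (kF (base U) (mult a)) (sQ (base U))
(sF (base U) (mult a)) cfun)` — `B9Eq360DeltaPrimeAY.eq360_deltaPrimeAY` conjugated by `conj b` and relabelled along the section `ιB` of `β`.
[cite: Balaban1985BackgroundPropagators, (3.60) p.402] -/
theorem ΔpC_mul_law [instD : DecidableEq (IBondY i)] (hι : ∀ s : BlkY i, β i.hN i.D i.hk (ιB s) = s) {U : CfgY 𝔸 i} (hU : GVal G i U) (a : AfldY 𝔸 i) :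
    ΔpC i par b (.prod U a)
      = ΔpC i par b (.base U)
        - conj b (vPrimeConc (shiftY i) (coordC G i (.base U)) (kGeo i).eta (expAC i (.base U) (.mult a)) (blkC i ιB)
            (kQC G i par (.base U)) (kFC i par (.base U) (.mult a)) (sQC G i par (.base U)) (sFC i par (.base U) (.mult a)) (cfunC i)) := by
  have hη : (kGeo i).eta ≠ 0 := by
    show |i.cf|⁻¹ ≠ 0
    exact inv_ne_zero (abs_ne_zero.2 i.hcf)
  obtain ⟨hco, hkQ, hsQ⟩ := letters_base_of_gVal G i par hU
  have key := B9Eq360DeltaPrimeAY.eq360_deltaPrimeAY i par hη a U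
  have hre := B9Eq360DeltaPrimeAY.vPrimeConc_reindex (shiftY i) (UboxY i U) (kGeo i).eta (chartA i a) (blkY i) ιB (β i.hN i.D i.hk) hι
    (kQY i par U) (kFY i par U (mulY i (fluct (kGeo i).eta a) U)) (sQY i par U) (sFY i par U (mulY i (fluct (kGeo i).eta a) U))
    ((((kGeo i).eta ^ 2)⁻¹) • cY i)
  have e1 : ΔpC i par b (.prod U a)
      = conj b ((((kGeo i).eta ^ 2)⁻¹) • (deltaPrimeAY i par (mulY i (fluct (kGeo i).eta a) U)).restrictScalars ℝ) := rfl
  have e2 : ΔpC i par b (.base U)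
      = conj b ((((kGeo i).eta ^ 2)⁻¹) • (deltaPrimeAY i par U).restrictScalars ℝ) := rfl
  rw [hco, hkQ, hsQ, e1, e2, key, conj_sub, ← hre]
  rfl


omit [NormedRing 𝔸] [NormedAlgebra ℂ 𝔸] [CompleteSpace 𝔸] in
/-- the frame's distance between labelled blocks IS p21's block distance on `𝔅` (the labelling is a section of `β`).
[cite: Balaban1984PropagatorsII, (2.46) p.231, bookkeeping] -/
theorem dist_blkC (hι : ∀ s : BlkY i, β i.hN i.D i.hk (ιB s) = s) (z z' : SiteY i) :
    (B9GeoNormsKLevelV1.geo9K i).dist (blkC i ιB z) (blkC i ιB z')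
      = ((B6Geom246MultiLevelTorus.bondT i.D).dist (blkOf i.D.toDomains z) (blkOf i.D.toDomains z') : ℝ) := by
  show (B6Geom246MultiLevelTorus.geomT i.D).dist (β i.hN i.D i.hk (ιB (blkY i z))) (β i.hN i.D i.hk (ιB (blkY i z'))) = _
  rw [hι, hι]
  rfl

omit [NormedRing 𝔸] [NormedAlgebra ℂ 𝔸] [CompleteSpace 𝔸] in
/-- a unit vector has sup-norm `≦ 1`. [folklore] [cite: Balaban1984PropagatorsII, (2.46) p.231, bookkeeping] -/
theorem abs_unitVec_le (μ ν : Fin (d + 1)) : |B6MultiLevelTorusOperator.unitVec μ ν| ≤ 1 := by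
  unfold B6MultiLevelTorusOperator.unitVec
  by_cases h : ν = μ
  · subst h; simp
  · simp [h]

omit [NormedRing 𝔸] [NormedAlgebra ℂ 𝔸] [CompleteSpace 𝔸] in
/-- ★ FIELD `stencilF`: the block of `z + e_μ` is within `2(d+1)` of the block of `z` (p21's neighbour lemma `distT_blkOf_tshift_le`).
[cite: Balaban1984PropagatorsII, (2.46) p.231, (2.2) p.224] -/
theorem stencilF_blkC (hι : ∀ s : BlkY i, β i.hN i.D i.hk (ιB s) = s) (μ : Fin (d + 1)) (z : SiteY i) :
    (B9GeoNormsKLevelV1.geo9K i).dist (blkC i ιB z) (blkC i ιB (shiftY i μ z)) ≤ 2 * ((d : ℝ) + 1) := by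
  have hMh : 3 ≤ i.Mh := le_trans (by norm_num) i.hM8
  have hR : 2 * (ℓ + 1) ≤ i.R := le_trans (Nat.mul_le_mul_left 2 (Nat.le_self_pow (by norm_num) (ℓ + 1))) i.hR2
  have hP4 : ∀ μ, 4 ≤ i.P' μ := fun μ => le_trans (by norm_num) (i.hP5 μ)
  rw [dist_blkC i ιB hι, SimpleGraph.dist_comm]
  exact_mod_cast B9Ineq344CutoffDatumTorus.distT_blkOf_tshift_le i.D hMh hR hP4 (B6MultiLevelTorusOperator.unitVec μ) (abs_unitVec_le μ) z

omit [NormedRing 𝔸] [NormedAlgebra ℂ 𝔸] [CompleteSpace 𝔸] in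
/-- ★ FIELD `stencilB`: the block of `z − e_μ` is within `2(d+1)` of the block of `z`. [cite: Balaban1984PropagatorsII, (2.46) p.231, (2.2) p.224] -/
theorem stencilB_blkC (hι : ∀ s : BlkY i, β i.hN i.D i.hk (ιB s) = s) (μ : Fin (d + 1)) (z : SiteY i) :
    (B9GeoNormsKLevelV1.geo9K i).dist (blkC i ιB z) (blkC i ιB ((shiftY i μ).symm z)) ≤ 2 * ((d : ℝ) + 1) := by
  have hMh : 3 ≤ i.Mh := le_trans (by norm_num) i.hM8
  have hR : 2 * (ℓ + 1) ≤ i.R := le_trans (Nat.mul_le_mul_left 2 (Nat.le_self_pow (by norm_num) (ℓ + 1))) i.hR2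
  have hP4 : ∀ μ, 4 ≤ i.P' μ := fun μ => le_trans (by norm_num) (i.hP5 μ)
  rw [dist_blkC i ιB hι, SimpleGraph.dist_comm, shiftY, B6MultiLevelTorusOperator.tshift_symm_apply]
  exact_mod_cast B9Ineq344CutoffDatumTorus.distT_blkOf_tshift_le i.D hMh hR hP4 (-B6MultiLevelTorusOperator.unitVec μ)
    (fun ν => by rw [Pi.neg_apply, abs_neg]; exact abs_unitVec_le μ ν) z

omit [NormedRing 𝔸] [NormedAlgebra ℂ 𝔸] [CompleteSpace 𝔸] in
/-- ★ FIELD `stencil0`: `d(y,y) ≦ 2(d+1)`. [cite: Balaban1984PropagatorsII, (2.46) p.231, bookkeeping] -/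
theorem stencil0_geo9K (y : IBondY i) : (B9GeoNormsKLevelV1.geo9K i).dist y y ≤ 2 * ((d : ℝ) + 1) := by
  rw [B9GeoLemma21KLevelV1.geo9K_dist_self]
  positivity

end Laws

end Literature.MathematicalPhysics.QuantumFieldTheory.Balaban1983to89.B9SectBGpLettersY
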